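import Summits.Langlands.Langlands.Theses.EisensteinGelfandKirillov
import Summits.Langlands.Langlands.Theorems.IrreducibilityBySelfDualityIrreducibleOffSectorOfReciprocity
import Literature.NumberTheory.Automorphic.ChebotarevArtinRepHolds
import Literature.NumberTheory.GaloisRepresentations.FramedRepEquivConj
import Summits.Langlands.Langlands.Theorems.IrreducibilityBySelfDualityReciprocityUpToIrreducibilityIsobaricRigidity
import Summits.Langlands.Langlands.Theorems.IrreducibilityBySelfDualityReciprocityUpToIrreducibilityDeRhamBlocks
import Summits.Langlands.Langlands.Theorems.IrreducibilityBySelfDualityReciprocityUpToIrreducibilityGeometricConstituents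
import Summits.Langlands.Langlands.Theorems.IrreducibilityBySelfDualityIrreducibleOffSectorIotaTransport
import Literature.NumberTheory.Automorphic.IsAutomorphicAE
import Literature.NumberTheory.Automorphic.GLnAdelicStructureProofs
import Literature.NumberTheory.GaloisRepresentations.GaloisRepFrobeniusProofs
import HarnessLib

/-!
# Skeleton — line `Sketch-18275-r1-k1` (idea `eisenstein-entry`) for crux stmt-Langlands-18275
`Summit.Langlands.Langlands.Theses.EisensteinGelfandKirillov.SectorComplement`
(`ReducibleCrystallineModular → _root_.Langlands`; lead prover-line-stmt-Langlands-18275-0, 2026-08-17)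

The crux is the route's declared FRAME item (rank 9): the summit `Langlands` modulo the route target
`X := ReducibleCrystallineModular` (Fontaine–Mazur in the residually upper-triangular, `p`-distinguished,
crystalline Hodge–Tate-regular `GL₂` sector over totally real `F`, `p ≥ 5` unramified — ordinarity NOT
assumed).  `Langlands → SectorComplement := fun h _ ↦ h`; `¬ SectorComplement ↔ X ∧ ¬ Langlands`.

## The line

`Langlands` along the summit's one certified seam `W → B_w → LGC → JS (2.2) → JS (2.3) → Langlands`
(`Cruxes/SectorToLanglands/Lines/SectorToLanglandsOfLeaves.lean`; landed bootstrap
`IrreducibleOffSector.langlands_of_reciprocityUpToIrreducibility_text_of_JS`, p115588), with the leaf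
B_w (Fontaine–Mazur–Langlands, a.e. form) CUT ALONG THE EISENSTEIN REGION `R(X)` = every rank-2
`ρ : Γ_K → GL₂(ℚ̄_ℓ)` (any `ℓ`, any `ι`, any residual image, any behaviour at `ℓ`) that is a COMPANION —
same complex Frobenius polynomials a.e. — of some `p`-adic member `ρ_p` of the sector `Σ_X`.
`X` discharges B_w on `R(X)` by a PROVED transport (§2, pure polynomial algebra: uniqueness of
Frobenius polynomials + injectivity of `Polynomial.map ι⁻¹`); the rest of B_w is the stub
`stub_weakAutomorphyOffEisenstein`.  Stubs (the ONLY sorries):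

* `stub_weakExistence` — W (OPEN CONJECTURE; verbatim 14328's / 14623's registered stub);
* `stub_weakAutomorphyOffEisenstein` — B_w OFF `R(X)` (OPEN CONJECTURE: lang.S03 for all `n`, all `K`
  minus a rank-2 region; the one stub specific to this line);
* `stub_pairCompatibilityForall` — LGC∀ (OPEN; local–global compatibility at every finite place for
  irreducible pinned-geometric a.e.-compatible pairs, for EVERY reciprocity datum `Rec` — the `∀ 𝓡`
  re-type of the summit (p141787, 2026-08-17) forces the `∀ Rec` form; rev 1's `∃ Rec` stub is expired);
* `stub_pairLBoundaryJS`, `stub_pairLPoleJS` — Arthur–Clozel (2.2)/(2.3) named facts BY NAME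
  ((2.2) = item stmt-Langlands-13622; (2.3) ⟸ Humphries–Jo in ranks ≥ 3, p132630);
* `stub_reciprocityDataNonempty` — RD: `∀ K, Nonempty (ReciprocityData K)` (the summit's new non-vacuity
  conjunct: a local Langlands datum at every completion with THE canonical Artin map; Harris–Taylor /
  Henniart + local class field theory — a THEOREM in print, a T0 debt of the tree).

`SectorComplement_of hW hOff hL hJSb hJSp hne : SectorComplement` — kernel-checked, hypotheses = the six stub
statements by name (`_Goal.stub_x := type_of% @stub_x`), conclusion = the route decl BY NAME, `X`
CONSUMED (it rebuilds B_w on `R(X)`).  Rev 2 (2026-08-17T06:xxZ): re-glued for the re-typed summit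
`Langlands F := Nonempty (ReciprocityData F) ∧ ∀ 𝓡 …` — the seam's last step is the `∀ 𝓡` bootstrap of
the lead's supports file `Theorems/EisensteinGelfandKirillovSectorComplementSeam.lean`
(`langlands_of_weak_leaves_forall`), inlined here until that file lands.

Disproof used: none exists (`ledger crux ls stmt-Langlands-18275`, 2026-08-17T04:4xZ: no Disproof.lean, no
`Theorems/SectorComplement/Negative/`); the homonymous 12923 NOTES.md §3 (L1–L4) is honoured — this is its
L3 with a typed, partly PROVED region.
-/

noncomputable section

set_option linter.dupNamespace false -- project-wide option; `Summit.Langlands.Langlands` is the mandated namespace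

open scoped NumberField Classical Polynomial Topology
open Filter IsDedekindDomain Polynomial
open Literature.NumberTheory.Automorphic Literature.NumberTheory.GaloisRepresentations
open Summit.Langlands
open Summit.Langlands.Langlands.Theorems.ReciprocityUpToIrreducibility
open Summit.Langlands.Langlands.Theorems.IrreducibleOffSector
open Summit.Langlands.Langlands.Theses.EisensteinGelfandKirillov (ReducibleCrystallineModular
  SectorComplement)

namespace Summit.Langlands.Langlands.Cruxes.SectorComplement.EisensteinEntry

/-! ## 0. The crux, by name -/

/-- The crux IS `X → Langlands`, definitionally. [folklore] -/
theorem sectorComplement_iff : SectorComplement ↔ (ReducibleCrystallineModular → _root_.Langlands) :=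
  Iff.rfl

/-! ## 1. The sector `Σ_X`, companions, the Eisenstein region `R(X)` -/

/-- `ρ_p ∈ Σ_X`: VERBATIM the hypotheses of the route target `ReducibleCrystallineModular` on a `p`-adic
`ρ_p : Γ_K → GL₂(ℚ̄_p)`. [cite: SkinnerWiles1999, Thm. A] -/
def InSector (K : Type) [Field K] [NumberField K] (p : ℕ) [Fact p.Prime]
    (ρp : FramedGaloisRep K (PadicAlgCl p) 2) : Prop :=
  NumberField.IsTotallyReal K ∧ 5 ≤ p ∧ ¬ ((p : ℤ) ∣ NumberField.discr K) ∧
    ρp.toGaloisRep.IsIrreducible ∧ ρp.IsOdd ∧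
    (∀ᶠ v : HeightOneSpectrum (𝓞 K) in cofinite, ρp.IsUnramifiedAt v) ∧
    ∃ (O : ValuationSubring (PadicAlgCl p))
      (_ : O = (Valued.v : Valuation (PadicAlgCl p) NNReal).valuationSubring)
      (ρ₀ : Field.absoluteGaloisGroup K →* Matrix.GeneralLinearGroup (Fin 2) O),
      ρp.HasUpperTriangularIntegralModel ρ₀ ∧
      ∀ (v : HeightOneSpectrum (𝓞 K)) (hv : ((p : ℕ) : 𝓞 K) ∈ v.asIdeal),
        IsPDistinguishedAt ρ₀ v ∧
        (Literature.NumberTheory.PAdicHodge.fontainePstAdicCompletion v p hv).IsCrystallineFramed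
          (ρp.toLocal v) ∧
        (letI := (Literature.NumberTheory.PAdicHodge.fontainePstAdicCompletion v p hv).algebra
         GaloisRep.IsLabelledHodgeTateRegular
          (Literature.NumberTheory.PAdicHodge.fontainePstAdicCompletion v p hv).𝔅
          (ρp.toLocal v).toGaloisRep)

/-- `ρ` (ℓ-adic, rank `n`, read through `ι`) and `ρ_p` (p-adic, rank 2, read through `ι_p`) are
COMPANIONS: at almost all places `ρ` is unramified and both have ONE common complex Frobenius
polynomial (Serre 1968 Ch. I §2.3).  Rank-free on the `ρ` side (for `n ≠ 2` it is never satisfied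
together with compatibility, but the statement needs no cast). [cite: SerreAbelianLadic1968, Ch. I §2.3] -/
def IsCompanion {K : Type} [Field K] [NumberField K] {n : ℕ} {ℓ p : ℕ} [Fact ℓ.Prime] [Fact p.Prime]
    (ι : PadicAlgCl ℓ ≃+* ℂ) (ιp : PadicAlgCl p ≃+* ℂ) (ρ : FramedGaloisRep K (PadicAlgCl ℓ) n)
    (ρp : FramedGaloisRep K (PadicAlgCl p) 2) : Prop :=
  ∀ᶠ v : HeightOneSpectrum (𝓞 K) in cofinite, ρ.IsUnramifiedAt v ∧
    ∃ P : Polynomial ℂ, ρ.HasFrobCharpolyAt v (P.map (ι.symm : ℂ →+* PadicAlgCl ℓ)) ∧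
      ρp.HasFrobCharpolyAt v (P.map (ιp.symm : ℂ →+* PadicAlgCl p))

/-- The EISENSTEIN REGION `R(X)` at rank `n`: `n = 2` and `ρ` has a companion in `Σ_X` at SOME prime `p`. -/
def InEisensteinRegion (K : Type) [Field K] [NumberField K] (n : ℕ) (ℓ : ℕ) [Fact ℓ.Prime]
    (ι : PadicAlgCl ℓ ≃+* ℂ) (ρ : FramedGaloisRep K (PadicAlgCl ℓ) n) : Prop :=
  n = 2 ∧ ∃ (p : ℕ) (_ : Fact p.Prime) (ιp : PadicAlgCl p ≃+* ℂ) (ρp : FramedGaloisRep K (PadicAlgCl p) 2),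
    InSector K p ρp ∧ IsCompanion ι ιp ρ ρp

/-! ## 2. PROVED: `X` discharges B_w on the Eisenstein region (the Eisenstein entry) -/

/-- **Companion transport of Satake–Frobenius compatibility** (any rank): if `π` on `GL_n(𝔸_K)` is
Satake–Frobenius compatible a.e. with `ρ_p` through `ι_p`, and `ρ` is a companion of `ρ_p` (common
complex Frobenius polynomials a.e., `ρ` unramified a.e.), then `π` is Satake–Frobenius compatible a.e.
with `ρ` through `ι`.  Pure algebra: the common polynomial IS the Satake polynomial (uniqueness of
Frobenius polynomials, `Polynomial.map ι_p⁻¹` injective), then read it through `ι`.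
[cite: SerreAbelianLadic1968, Ch. I §2.3] -/
theorem eventually_satakeFrobCompatibleAt_of_companion {K : Type} [Field K] [NumberField K] {n : ℕ}
    {hcpt : isCompact_glFiniteIntegralLevel n K} {ℓ p : ℕ} [Fact ℓ.Prime] [Fact p.Prime]
    (ι : PadicAlgCl ℓ ≃+* ℂ) (ιp : PadicAlgCl p ≃+* ℂ) (π : AutomorphicRepData (AutomorphyDatum.gl n K hcpt))
    (ρ : FramedGaloisRep K (PadicAlgCl ℓ) n) (ρp : FramedGaloisRep K (PadicAlgCl p) n)
    (hπ : ∀ᶠ v : HeightOneSpectrum (𝓞 K) in cofinite, SatakeFrobCompatibleAt ιp π ρp v)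
    (hcomp : ∀ᶠ v : HeightOneSpectrum (𝓞 K) in cofinite, ρ.IsUnramifiedAt v ∧
      ∃ P : Polynomial ℂ, ρ.HasFrobCharpolyAt v (P.map (ι.symm : ℂ →+* PadicAlgCl ℓ)) ∧
        ρp.HasFrobCharpolyAt v (P.map (ιp.symm : ℂ →+* PadicAlgCl p))) :
    ∀ᶠ v : HeightOneSpectrum (𝓞 K) in cofinite, SatakeFrobCompatibleAt ι π ρ v := by
  filter_upwards [hπ, hcomp] with v hv hv'
  obtain ⟨α, hα, -, hcp⟩ := hv
  obtain ⟨hurρ, P, hPρ, hPp⟩ := hv'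
  have h1 : P.map (ιp.symm : ℂ →+* PadicAlgCl p) = arithFrobPolyOfSatake ιp v.residueCard 1 α :=
    GaloisRep.HasFrobCharpolyAt.unique_holds
      ((FramedGaloisRep.hasFrobCharpolyAt_toGaloisRep_iff v _ ρp).mpr hPp)
      ((FramedGaloisRep.hasFrobCharpolyAt_toGaloisRep_iff v _ ρp).mpr hcp)
  rw [Summit.Langlands.Langlands.Theorems.IrreducibleOffSector.arithFrobPolyOfSatake_one_eq_map] at h1
  obtain rfl := Polynomial.map_injective _ ιp.symm.injective h1
  refine ⟨α, hα, hurρ, ?_⟩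
  rwa [Summit.Langlands.Langlands.Theorems.IrreducibleOffSector.arithFrobPolyOfSatake_one_eq_map]

/-- **Eisenstein entry** — `X` ⇒ B_w on the Eisenstein region: every `ρ` in `R(X)` is Satake–Frobenius
compatible a.e. with an L-algebraic cuspidal `π` of `GL₂(𝔸_K)` (apply `X` to the companion `ρ_p ∈ Σ_X`,
then transport).  NO hypothesis on `ρ` itself. [cite: SerreAbelianLadic1968, Ch. I §2.3] -/
theorem eisensteinRegionAutomorphy_of_X (hX : ReducibleCrystallineModular) (K : Type) [Field K]
    [NumberField K] (n : ℕ) (hcpt : isCompact_glFiniteIntegralLevel n K) (ℓ : ℕ) [Fact ℓ.Prime]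
    (ι : PadicAlgCl ℓ ≃+* ℂ) (ρ : FramedGaloisRep K (PadicAlgCl ℓ) n)
    (hreg : InEisensteinRegion K n ℓ ι ρ) :
    ∃ π : CuspidalAutomorphicRepData n K hcpt, π.1.IsLAlgebraic ∧
      ∀ᶠ v : HeightOneSpectrum (𝓞 K) in cofinite, SatakeFrobCompatibleAt ι π.1 ρ v := by
  obtain ⟨rfl, p, hp, ιp, ρp, hsec, hcomp⟩ := hreg
  obtain ⟨hK, h5, hdisc, hirr, hodd, hur, O, hO, ρ₀, hup, hloc⟩ := hsec
  obtain ⟨π, hL, hπ⟩ := hX K hK p h5 hdisc O hO hcpt ιp ρp ρ₀ hirr hodd hur hup hloc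
  exact ⟨π, hL, eventually_satakeFrobCompatibleAt_of_companion ι ιp π.1 ρ ρp hπ hcomp⟩

/-! ## 3. The five stubs (the ONLY sorries of this file) -/

/-- **stub W — weak existence** (Buzzard–Gee Conj. 3.2.2, existence half, weak form; OPEN beyond regular
algebraic `π` over CM / totally real `K`).  Verbatim the registered stub of stmt-Langlands-14328 / 14623.
[cite: BuzzardGeeLMS2014, Conj. 3.2.2] [cite: FontaineMazurGeometric1995, §1] -/
theorem stub_weakExistence : ∀ (K : Type) [Field K] [NumberField K] (n : ℕ) (hcpt : Literature.NumberTheory.Automorphic.isCompact_glFiniteIntegralLevel n K), 0 < n → ∀ π : Literature.NumberTheory.Automorphic.CuspidalAutomorphicRepData n K hcpt, π.1.IsLAlgebraic → ∀ (ℓ : ℕ) [Fact ℓ.Prime] (ι : PadicAlgCl ℓ ≃+* ℂ), ∃ ρ : Literature.NumberTheory.GaloisRepresentations.FramedGaloisRep K (PadicAlgCl ℓ) n, ((∀ᶠ v : IsDedekindDomain.HeightOneSpectrum (NumberField.RingOfIntegers K) in cofinite, ρ.IsUnramifiedAt v) ∧ ∀ (v : IsDedekindDomain.HeightOneSpectrum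 (NumberField.RingOfIntegers K)) (hv : ((ℓ : ℕ) : NumberField.RingOfIntegers K) ∈ v.asIdeal), (Literature.NumberTheory.PAdicHodge.fontainePstAdicCompletion v ℓ hv).IsDeRhamFramed (ρ.toLocal v)) ∧ ∀ᶠ v : IsDedekindDomain.HeightOneSpectrum (NumberField.RingOfIntegers K) in cofinite, SatakeFrobCompatibleAt ι π.1 ρ v := by
  sorry

/-- **stub B_w^off — weak automorphy OFF the Eisenstein region** (Fontaine–Mazur 1995 Conj. 1 + Langlands,
a.e. form, every `n ≥ 1`, every number field `K`, EXCEPT rank-2 companions of a `Σ_X` member; OPEN —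
it is lang.S03 minus a thin `GL₂`/totally-real region; every catalogued barrier bites).  The region is
written out (no local definition) so that the registered signature is self-contained; it is
`InEisensteinRegion K n ℓ ι ρ` definitionally. [cite: FontaineMazurGeometric1995, Conj. 1]
[cite: BuzzardGeeLMS2014, Conj. 3.2.2] -/
theorem stub_weakAutomorphyOffEisenstein : ∀ (K : Type) [Field K] [NumberField K] (n : ℕ) (hcpt : Literature.NumberTheory.Automorphic.isCompact_glFiniteIntegralLevel n K), 0 < n → ∀ (ℓ : ℕ) [Fact ℓ.Prime] (ι : PadicAlgCl ℓ ≃+* ℂ) (ρ : Literature.NumberTheory.GaloisRepresentations.FramedGaloisRep K (PadicAlgCl ℓ) n), ρ.toGaloisRep.IsIrreducible → ((∀ᶠ v : IsDedekindDomain.HeightOneSpectrum (NumberField.RingOfIntegers K) in cofinite, ρ.IsUnramifiedAt v) ∧ ∀ (v : IsDedekindDomain.HeightOneSpectrum (NumberField.RingOfIntegers K)) (hv : ((ℓ : ℕ) : NumberField.RingOfIntegers K) ∈ v.asIdeal), (Literature.NumberTheory.PAdicHodge.fontainePstAdicCompletion v ℓ hv).IsDeRhamFramed (ρ.toLocal v))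 → ¬ (n = 2 ∧ ∃ (p : ℕ) (_ : Fact p.Prime) (ιp : PadicAlgCl p ≃+* ℂ) (ρp : Literature.NumberTheory.GaloisRepresentations.FramedGaloisRep K (PadicAlgCl p) 2), (NumberField.IsTotallyReal K ∧ 5 ≤ p ∧ ¬ ((p : ℤ) ∣ NumberField.discr K) ∧ ρp.toGaloisRep.IsIrreducible ∧ ρp.IsOdd ∧ (∀ᶠ v : IsDedekindDomain.HeightOneSpectrum (NumberField.RingOfIntegers K) in cofinite, ρp.IsUnramifiedAt v) ∧ ∃ (O : ValuationSubring (PadicAlgCl p)) (_ : O = (Valued.v : Valuation (PadicAlgCl p) NNReal).valuationSubring) (ρ₀ : Field.absoluteGaloisGroup K →* Matrix.GeneralLinearGroup (Fin 2) O), ρp.HasUpperTriangularIntegralModel ρ₀ ∧ ∀ (v : IsDedekindDomain.HeightOneSpectrum (NumberField.RingOfIntegers K)) (hv : ((p : ℕ) : NumberField.RingOfIntegers K) ∈ v.asIdeal), Literature.NumberTheory.GaloisRepresentations.IsPDistinguishedAt ρ₀ v ∧ (Literature.NumberTheory.PAdicHodge.fontainePstAdicCompletion v p hv).IsCrystallineFramed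 (ρp.toLocal v) ∧ (letI := (Literature.NumberTheory.PAdicHodge.fontainePstAdicCompletion v p hv).algebra; Literature.NumberTheory.GaloisRepresentations.GaloisRep.IsLabelledHodgeTateRegular (Literature.NumberTheory.PAdicHodge.fontainePstAdicCompletion v p hv).𝔅 (ρp.toLocal v).toGaloisRep)) ∧ ∀ᶠ v : IsDedekindDomain.HeightOneSpectrum (NumberField.RingOfIntegers K) in cofinite, ρ.IsUnramifiedAt v ∧ ∃ P : Polynomial ℂ, ρ.HasFrobCharpolyAt v (P.map (ι.symm : ℂ →+* PadicAlgCl ℓ)) ∧ ρp.HasFrobCharpolyAt v (P.map (ιp.symm : ℂ →+* PadicAlgCl p))) → ∃ π : Literature.NumberTheory.Automorphic.CuspidalAutomorphicRepData n K hcpt, π.1.IsLAlgebraic ∧ ∀ᶠ v : IsDedekindDomain.HeightOneSpectrum (NumberField.RingOfIntegers K) in cofinite, SatakeFrobCompatibleAt ι π.1 ρ v := by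
  sorry

/-- **stub LGC∀ — pair compatibility for every reciprocity datum** (Taylor 2004 Conj. 7 for irreducible
pinned-geometric a.e.-compatible pairs: local–global compatibility at EVERY finite place, relative to EVERY
Henniart-normalised reciprocity datum `Rec` — the pins `ReciprocityData.llc_isCanonical/llc_eps_isCanonical`
make all data agree on `rec₁` and on Deligne's `ε`; OPEN in general).  The `∀ Rec` form forced by the
`∀ 𝓡` re-type of the summit. [cite: TaylorGaloisRepresentations2004, Conj. 7] [cite: HarrisTaylorAMS2001, Thm. A] -/
theorem stub_pairCompatibilityForall : ∀ (K : Type) [Field K] [NumberField K] (Rec : ReciprocityData K) (n : ℕ) (hcpt : Literature.NumberTheory.Automorphic.isCompact_glFiniteIntegralLevel n K), 0 < n → ∀ (π : Literature.NumberTheory.Automorphic.CuspidalAutomorphicRepData n K hcpt), π.1.IsLAlgebraic → ∀ (ℓ : ℕ) [Fact ℓ.Prime] (ι : PadicAlgCl ℓ ≃+* ℂ) (ρ : Literature.NumberTheory.GaloisRepresentations.FramedGaloisRep K (PadicAlgCl ℓ) n), ρ.toGaloisRep.IsIrreducible → ((∀ᶠ v : IsDedekindDomain.HeightOneSpectrum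 (NumberField.RingOfIntegers K) in cofinite, ρ.IsUnramifiedAt v) ∧ ∀ (v : IsDedekindDomain.HeightOneSpectrum (NumberField.RingOfIntegers K)) (hv : ((ℓ : ℕ) : NumberField.RingOfIntegers K) ∈ v.asIdeal), (Literature.NumberTheory.PAdicHodge.fontainePstAdicCompletion v ℓ hv).IsDeRhamFramed (ρ.toLocal v)) → (∀ᶠ v : IsDedekindDomain.HeightOneSpectrum (NumberField.RingOfIntegers K) in cofinite, SatakeFrobCompatibleAt ι π.1 ρ v) → ∀ v : IsDedekindDomain.HeightOneSpectrum (NumberField.RingOfIntegers K), LocalGlobalCompatibleAt Rec ι π.1 ρ v := by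
  sorry

/-- **stub JS (2.2)** — Arthur–Clozel Ch. 3 (2.2) for Borel–Jacquet data, the Literature named fact BY NAME
(= item stmt-Langlands-13622 `IrreducibilityBySelfDuality.PairLBoundaryJS` definitionally; a THEOREM in print).
[cite: ArthurClozelAMS120, Ch. 3 §2 (2.2)] [cite: JacquetShalikaAJM1981II, Prop. 3.6 and Thm. 4.4] -/
theorem stub_pairLBoundaryJS : Literature.NumberTheory.Automorphic.JacquetShalika1981_partialPairL_boundary_repData := by
  sorry

/-- **stub JS (2.3)** — Arthur–Clozel Ch. 3 (2.3) for Borel–Jacquet data, the Literature named fact BY NAME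
(a THEOREM in print; ranks ≤ 2 in tree, ranks ≥ 3 ⟸ Humphries–Jo 2024, p132630).
[cite: ArthurClozelAMS120, Ch. 3 §2 (2.3)] [cite: JacquetShalikaAJM1981II, Prop. 3.6] -/
theorem stub_pairLPoleJS : Literature.NumberTheory.Automorphic.JacquetShalika1981_partialPairL_pole_repData := by
  sorry

/-- **stub RD — reciprocity data exist** (the summit's non-vacuity conjunct after the `∀ 𝓡` re-type):
for every number field `K` and every finite place `v`, a local Langlands datum for the general linear
groups over `K_v` whose local Artin map (and those of its `ε`-system) is THE canonical one.  Harris–Taylor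
2001 Thm. A / Henniart 2000 Thm. 1.2 with local class field theory: a THEOREM in print; in the tree the
named fact `LocalLanglandsDatum.nonempty` plus the canonicity of its normalisation (T0 debt).
[cite: HarrisTaylorAMS2001, Thm. A] [cite: HenniartInventiones2000, Thm. 1.2] -/
theorem stub_reciprocityDataNonempty : ∀ (K : Type) [Field K] [NumberField K], Nonempty (ReciprocityData K) := by
  sorry

/-! ## 4. The stub statements as named propositions -/

namespace _Goal

/-- The statement of `stub_weakExistence` (literally its type). [folklore] -/
def stub_weakExistence : Prop :=
  type_of% @Summit.Langlands.Langlands.Cruxes.SectorComplement.EisensteinEntry.stub_weakExistence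

/-- The statement of `stub_weakAutomorphyOffEisenstein` (literally its type). [folklore] -/
def stub_weakAutomorphyOffEisenstein : Prop :=
  type_of% @Summit.Langlands.Langlands.Cruxes.SectorComplement.EisensteinEntry.stub_weakAutomorphyOffEisenstein

/-- The statement of `stub_pairCompatibilityForall` (literally its type). [folklore] -/
def stub_pairCompatibilityForall : Prop :=
  type_of% @Summit.Langlands.Langlands.Cruxes.SectorComplement.EisensteinEntry.stub_pairCompatibilityForall

/-- The statement of `stub_pairLBoundaryJS` (literally its type). [folklore] -/
def stub_pairLBoundaryJS : Prop :=
  type_of% @Summit.Langlands.Langlands.Cruxes.SectorComplement.EisensteinEntry.stub_pairLBoundaryJS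

/-- The statement of `stub_pairLPoleJS` (literally its type). [folklore] -/
def stub_pairLPoleJS : Prop :=
  type_of% @Summit.Langlands.Langlands.Cruxes.SectorComplement.EisensteinEntry.stub_pairLPoleJS

/-- The statement of `stub_reciprocityDataNonempty` (literally its type). [folklore] -/
def stub_reciprocityDataNonempty : Prop :=
  type_of% @Summit.Langlands.Langlands.Cruxes.SectorComplement.EisensteinEntry.stub_reciprocityDataNonempty

end _Goal

/-! ## 5. The `∀ 𝓡` seam, inlined (lands separately as `SectorComplementSeam.langlands_of_weak_leaves_forall`) -/

/-- **`Langlands` (re-typed, `∀ 𝓡`) from reciprocity up to irreducibility for EVERY reciprocity datum,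
Arthur–Clozel (2.2)–(2.3) and RD** — verbatim the lead's supports theorem
`SectorComplementSeam.langlands_of_reciprocityUpToIrreducibility_forall_text_of_JS` (inlined until it lands).
[cite: CalegariGee2013, §1.1] [cite: BuzzardGeeLMS2014, Conj. 3.2.1 and Conj. 3.2.2] [cite: DeligneSerreASENS1974, Lemme 3.2] -/
theorem langlands_of_reciprocityUpToIrreducibility_forall_text_of_JS
    (h22 : JacquetShalika1981_partialPairL_boundary_repData)
    (h23 : JacquetShalika1981_partialPairL_pole_repData)
    (hne : ∀ (F : Type) [Field F] [NumberField F], Nonempty (ReciprocityData F))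
    (cE : ∀ (F : Type) [Field F] [NumberField F] (Rec : ReciprocityData F) (n : ℕ), 0 < n →
      ∀ hcpt : isCompact_glFiniteIntegralLevel n F,
        (∀ π : CuspidalAutomorphicRepData n F hcpt, π.1.IsLAlgebraic →
          ∀ (ℓ : ℕ) [Fact ℓ.Prime] (ι : PadicAlgCl ℓ ≃+* ℂ),
            ∃ ρ : FramedGaloisRep F (PadicAlgCl ℓ) n, IsGeometricFramed Rec ρ ∧ Corresponds Rec ι π.1 ρ) ∧
        GaloisToAutomorphic n Rec hcpt) :
    _root_.Langlands := by
  intro F _ _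
  refine ⟨hne F, fun Rec n hn hcpt => ?_⟩
  have hRec := fun n hn hcpt => cE F Rec n hn hcpt
  obtain ⟨hA, hB⟩ := cE F Rec n hn hcpt
  refine ⟨?_, hB⟩
  intro π hL ℓ _ ι
  -- irreducibility of EVERY avatar Satake–Frobenius compatible a.e. with `π`: the isobaric bootstrap
  have irr : ∀ ρ : FramedGaloisRep F (PadicAlgCl ℓ) n,
      (∀ᶠ v : HeightOneSpectrum (𝓞 F) in cofinite, SatakeFrobCompatibleAt ι π.1 ρ v) →
        ρ.toGaloisRep.IsIrreducible :=
    fun ρ hρ => isIrreducible_of_reciprocityUpToIrreducibility h22 h23 hRec hcpt hn π hL ι ρ hρ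
  obtain ⟨ρ, hgeo, hcorr⟩ := hA π hL ℓ ι
  refine ⟨ρ, irr ρ hcorr.1, hgeo, hcorr, fun ρ' hcorr' => ?_⟩
  -- uniqueness up to conjugacy: irreducible ⇒ semisimple; equal Satake parameters a.e.
  -- ⇒ equal Frobenius polynomials a.e. ⇒ equivalent (Chebotarev + Brauer–Nesbitt) ⇒ conjugate
  have h1 : ρ.toGaloisRep.IsIrreducible := irr ρ hcorr.1
  have h2 : ρ'.toGaloisRep.IsIrreducible := irr ρ' hcorr'.1
  have hs1 : ρ.toGaloisRep.IsSemisimple := by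
    haveI := h1
    change ComplementedLattice _
    infer_instance
  have hs2 : ρ'.toGaloisRep.IsSemisimple := by
    haveI := h2
    change ComplementedLattice _
    infer_instance
  have hev : ∀ᶠ v : HeightOneSpectrum (𝓞 F) in cofinite,
      ρ.IsUnramifiedAt v ∧ ρ'.IsUnramifiedAt v ∧
        ∃ P : Polynomial (PadicAlgCl ℓ), ρ.HasFrobCharpolyAt v P ∧ ρ'.HasFrobCharpolyAt v P := by
    filter_upwards [hcorr.1, hcorr'.1] with v hv hv'
    obtain ⟨α, hα, hur, hcp⟩ := hv
    obtain ⟨α', hα', hur', hcp'⟩ := hv'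
    obtain rfl : α = α' := AutomorphicRepData.hasSatakeParamAt_unique_holds π.1 hα hα'
    exact ⟨hur, hur', _, hcp, hcp'⟩
  obtain ⟨e⟩ := FramedGaloisRep.nonempty_equiv_of_hasFrobCharpolyAt_eventually
    chebotarev_artinRep_holds ρ ρ' hs1 hs2 hev
  obtain ⟨P, hP⟩ := FramedRep.exists_eq_conj_of_equiv ρ ρ' e
  exact ⟨P, hP.symm⟩

/-! ## 6. The composition (kernel-checked, no `sorry`): W → B_w^off → LGC∀ → JS (2.2) → JS (2.3) → RD → SectorComplement,
with `X` consumed on the Eisenstein region -/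

/-- **`SectorComplement` from its six stubs.**  Given `X` (the crux's antecedent), B_w is rebuilt by a case
split on the Eisenstein region: ON the region `X` + the proved transport (`eisensteinRegionAutomorphy_of_X`),
OFF the region the stub; then the isobaric bootstrap (irreducibility of W's avatar of a cuspidal `π`:
geometric constituents + de Rham heredity, B_w on the constituents, Jacquet–Shalika rigidity), the packaging
of reciprocity-up-to-irreducibility for EVERY `Rec` of LGC∀, and the `∀ 𝓡` bootstrap
`langlands_of_reciprocityUpToIrreducibility_forall_text_of_JS` with RD.  Hypotheses = the six stub statements
by name; conclusion = the route decl by name. [cite: BuzzardGeeLMS2014, Conj. 3.2.1 and Conj. 3.2.2]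
[cite: ArthurClozelAMS120, Ch. 3 §2 (2.2)–(2.3)] [cite: CalegariGee2013, §1.1] [cite: DeligneSerreASENS1974, Lemme 3.2] -/
theorem SectorComplement_of (hW : _Goal.stub_weakExistence) (hOff : _Goal.stub_weakAutomorphyOffEisenstein)
    (hL : _Goal.stub_pairCompatibilityForall) (hJSb : _Goal.stub_pairLBoundaryJS)
    (hJSp : _Goal.stub_pairLPoleJS) (hne : _Goal.stub_reciprocityDataNonempty) : SectorComplement := by
  rw [sectorComplement_iff]
  intro hX
  dsimp only [_Goal.stub_weakExistence, _Goal.stub_weakAutomorphyOffEisenstein, _Goal.stub_pairCompatibilityForall,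
    _Goal.stub_pairLBoundaryJS, _Goal.stub_pairLPoleJS, _Goal.stub_reciprocityDataNonempty] at hW hOff hL hJSb hJSp hne
  -- B_w (Fontaine–Mazur–Langlands, a.e. form) from its two halves: the Eisenstein region is discharged by X
  have hB : ∀ (K : Type) [Field K] [NumberField K] (n : ℕ) (hcpt : Literature.NumberTheory.Automorphic.isCompact_glFiniteIntegralLevel n K), 0 < n → ∀ (ℓ : ℕ) [Fact ℓ.Prime] (ι : PadicAlgCl ℓ ≃+* ℂ) (ρ : Literature.NumberTheory.GaloisRepresentations.FramedGaloisRep K (PadicAlgCl ℓ) n), ρ.toGaloisRep.IsIrreducible → ((∀ᶠ v : IsDedekindDomain.HeightOneSpectrum (NumberField.RingOfIntegers K) in cofinite, ρ.IsUnramifiedAt v) ∧ ∀ (v : IsDedekindDomain.HeightOneSpectrum (NumberField.RingOfIntegers K)) (hv : ((ℓ : ℕ) : NumberField.RingOfIntegers K) ∈ v.asIdeal), (Literature.NumberTheory.PAdicHodge.fontainePstAdicCompletion v ℓ hv).IsDeRhamFramed (ρ.toLocal v)) → ∃ π : Literature.NumberTheory.Automorphic.CuspidalAutomorphicRepData n K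 hcpt, π.1.IsLAlgebraic ∧ ∀ᶠ v : IsDedekindDomain.HeightOneSpectrum (NumberField.RingOfIntegers K) in cofinite, SatakeFrobCompatibleAt ι π.1 ρ v := by
    intro K _ _ n hcpt hn ℓ _ ι ρ hirr hgeo
    by_cases hreg : InEisensteinRegion K n ℓ ι ρ
    · exact eisensteinRegionAutomorphy_of_X hX K n hcpt ℓ ι ρ hreg
    · exact hOff K n hcpt hn ℓ ι ρ hirr hgeo hreg
  -- the isobaric bootstrap, run with B_w: a pinned-geometric avatar of a cuspidal `π` is irreducible
  have irr : ∀ (K : Type) [Field K] [NumberField K] (n : ℕ) (hcpt : isCompact_glFiniteIntegralLevel n K)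
      (_ : 0 < n) (π : CuspidalAutomorphicRepData n K hcpt) (ℓ : ℕ) [Fact ℓ.Prime]
      (ι : PadicAlgCl ℓ ≃+* ℂ) (ρ : FramedGaloisRep K (PadicAlgCl ℓ) n),
      ((∀ᶠ v : HeightOneSpectrum (𝓞 K) in cofinite, ρ.IsUnramifiedAt v) ∧
        ∀ (v : HeightOneSpectrum (𝓞 K)) (hv : ((ℓ : ℕ) : 𝓞 K) ∈ v.asIdeal),
          (Literature.NumberTheory.PAdicHodge.fontainePstAdicCompletion v ℓ hv).IsDeRhamFramed
            (ρ.toLocal v)) →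
      (∀ᶠ v : HeightOneSpectrum (𝓞 K) in cofinite, SatakeFrobCompatibleAt ι π.1 ρ v) →
        ρ.toGaloisRep.IsIrreducible := by
    intro K _ _ n hcpt hn π ℓ _ ι ρ hgeo hρ
    obtain ⟨k, m, r, hr, hchar, -, hone⟩ :=
      stub_geometricConstituents stub_deRhamBlocks K ℓ n ρ hn hgeo
    by_cases hk1 : k = 1
    · exact hone hk1
    have hk0 : k ≠ 0 := by
      rintro rfl
      have h1 := hchar 1
      simp only [Finset.univ_eq_empty, Finset.prod_empty] at h1
      have hdeg : (FramedRep.charpoly ρ 1).natDegree = n := by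
        simp [FramedRep.charpoly, Matrix.charpoly_natDegree_eq_dim]
      rw [h1, natDegree_one] at hdeg
      omega
    have hk2 : 2 ≤ k := by omega
    have hσ : ∀ i, ∃ σ : CuspidalAutomorphicRepData (m i) K
        (isCompact_glFiniteIntegralLevel_holds (m i) K),
        ∀ᶠ v : HeightOneSpectrum (𝓞 K) in cofinite, SatakeFrobCompatibleAt ι σ.1 (r i) v := by
      intro i
      obtain ⟨σ, -, hcorr⟩ := hB K (m i) (isCompact_glFiniteIntegralLevel_holds (m i) K) (hr i).1 ℓ ι
        (r i) (hr i).2.1 (hr i).2.2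
      exact ⟨σ, hcorr⟩
    choose σ hσc using hσ
    refine (stub_isobaricRigidity hJSb hJSp K n hcpt π k m
      (fun i => isCompact_glFiniteIntegralLevel_holds (m i) K) σ hn hk2 (fun i => (hr i).1) ?_).elim
    have hall : ∀ᶠ v : HeightOneSpectrum (𝓞 K) in cofinite,
        ∀ i, SatakeFrobCompatibleAt ι (σ i).1 (r i) v :=
      Filter.eventually_all.mpr hσc
    filter_upwards [hρ, hall] with v hv hvi
    intro α hα
    obtain ⟨α₀, hα₀, -, hcp⟩ := hv
    obtain rfl : α = α₀ := AutomorphicRepData.hasSatakeParamAt_unique_holds π.1 hα hα₀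
    choose β hβ _hurβ hcpβ using hvi
    refine ⟨β, hβ, ?_⟩
    have hprod : ρ.HasFrobCharpolyAt v (∏ i, arithFrobPolyOfSatake ι v.residueCard 1 (β i)) := by
      intro 𝔓 h𝔓 τ hτ
      rw [hchar τ]
      exact Finset.prod_congr rfl fun i _ => hcpβ i 𝔓 h𝔓 τ hτ
    rw [← Summit.Langlands.Langlands.Theorems.IrreducibleOffSector.arithFrobPolyOfSatake_sum] at hprod
    have heq : arithFrobPolyOfSatake ι v.residueCard 1 α =
        arithFrobPolyOfSatake ι v.residueCard 1 (∑ i, β i) :=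
      GaloisRep.HasFrobCharpolyAt.unique_holds
        ((FramedGaloisRep.hasFrobCharpolyAt_toGaloisRep_iff v _ ρ).mpr hcp)
        ((FramedGaloisRep.hasFrobCharpolyAt_toGaloisRep_iff v _ ρ).mpr hprod)
    exact arithFrobPolyOfSatake_one_injective ι _ heq
  -- reciprocity up to irreducibility for EVERY `Rec` of LGC∀
  have hE : ∀ (F : Type) [Field F] [NumberField F] (Rec : ReciprocityData F) (n : ℕ), 0 < n →
      ∀ hcpt : isCompact_glFiniteIntegralLevel n F,
        (∀ π : CuspidalAutomorphicRepData n F hcpt, π.1.IsLAlgebraic →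
          ∀ (ℓ : ℕ) [Fact ℓ.Prime] (ι : PadicAlgCl ℓ ≃+* ℂ),
            ∃ ρ : FramedGaloisRep F (PadicAlgCl ℓ) n, IsGeometricFramed Rec ρ ∧ Corresponds Rec ι π.1 ρ) ∧
        GaloisToAutomorphic n Rec hcpt := by
    intro F _ _ Rec n hn hcpt
    refine ⟨fun π hLalg ℓ _ ι => ?_, fun ℓ _ ι ρ hirr hgeo => ?_⟩
    · obtain ⟨ρ, hgeo, hρ⟩ := hW F n hcpt hn π hLalg ℓ ι
      have hirr : ρ.toGaloisRep.IsIrreducible := irr F n hcpt hn π ℓ ι ρ hgeo hρ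
      exact ⟨ρ, hgeo, hρ, hL F Rec n hcpt hn π hLalg ℓ ι ρ hirr hgeo hρ⟩
    · obtain ⟨π, hLalg, hρ⟩ := hB F n hcpt hn ℓ ι ρ hirr hgeo
      exact ⟨π, hLalg, hρ, hL F Rec n hcpt hn π hLalg ℓ ι ρ hirr hgeo hρ⟩
  -- the summit (∀ 𝓡): irreducibility of every avatar and Chebotarev–Brauer–Nesbitt uniqueness, with RD
  exact langlands_of_reciprocityUpToIrreducibility_forall_text_of_JS hJSb hJSp hne hE

/-- By-name sanity check (an `example`, not a declaration): the six stubs feed the composition as they stand. -/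
example : SectorComplement :=
  SectorComplement_of stub_weakExistence stub_weakAutomorphyOffEisenstein stub_pairCompatibilityForall
    stub_pairLBoundaryJS stub_pairLPoleJS stub_reciprocityDataNonempty

end Summit.Langlands.Langlands.Cruxes.SectorComplement.EisensteinEntry

end
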